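import Summits.Ventures.GridStability.Bench.WSCC9Deg4ASosgramDinst
import Summits.Ventures.GridStability.Lyapunov.CertificateSoundness
import Summits.Ventures.GridStability.Bench.WSCC9Deg4ASosgramDinstRoaLinks
import Summits.Ventures.GridStability.Lyapunov.PolyRecastEval
import Summits.Ventures.GridStability.Lyapunov.PolyRecastLieChunks
import Mathlib.Analysis.Calculus.Deriv.Pi
import Mathlib.Analysis.Normed.Module.FiniteDimension
import HarnessLib

/-!
# G1.WSCC9+ deg-4 (D-INSTANCE, wider domain)-roa (recast half) — from the kernel-checked certificate
# `Bench/WSCC9Deg4ASosgramDinst` to invariance and attraction of the certified sublevel piece FOR THE RECAST MODEL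

Venture GRIDFUSION, `plan/PARTITION.md` A2 (G1-alg / G1-roa), A5 (bridge), A6 (pole-slip rule), RULING 19 (2)
(second deg-4 claim «G1.WSCC9+ deg-4 (D-instance, wider domain)») and the lead's R-DINST-ORDER (sos-3 files the
set); seat gridfusion-sos-3 (g3) running gridfusion-lyap-1's generator `gen6.py` (HOME/lean/tools/lyap-1/; chain
rule via `Lyapunov/PolyRecast.lean`, p482110) with ONE substitution: this certificate's `V` has 253 monomials,
above the emitter's 150-term cap for an explicit `…_V_eq` lemma, so continuity of `V` and `V(0) = 0` come from
the generic `Lyapunov/PolyRecastEval.lean` (p499980: `continuous_eval_ofFn`, `eval_ofFn_zero_of_all` — one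
`decide` on the literal) instead of `simp only [_V_eq]; fun_prop`; and (second substitution) the chain-rule link
`V̇ = lieDeriv f V` is checked in SEVEN field-component links with literal partial sums (`…RoaData1/2.lean`,
`Lyapunov/PolyRecastLieChunks.lean`) because the one-`decide` link of the template does not reduce at 253 × 7 terms. Companion of
`Bench/WSCC9Deg4ASosgramDinst{Data1–20, Psd1–5, Chk1–3, Part1–3, }.lean` (source certificate = certnum-sdp-3's
toolchain-A′ exact re-cert `WSCC9-deg4-A-sosgram-Dinst.json` 9d83c75afa575de8 of sos-3's claim instance
`cert/sos-3/runs/j261218/WSCC9-deg4-instance.json` 741461ba; other exact lineages of the SAME claim: A sos-1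
b2f75d97, B sos-2 1ea0353b, D driver 82c11cf6), whose decls it uses VERBATIM (`deg4_A_sosgram_Dinst_{f_<var>,
h1, h2, V, Vdot}` + `_poly`, and the CERTIFIED identities `deg4_A_sosgram_Dinst_{V_pos, Vdot_neg, dom_incl_0,
dom_incl_1}`).

THREE COLUMNS. CERTIFIED (kernel, in the Bench files): `V ≥ ε_pos·φ` on `{h = 0}` (ε_pos = 1/1000,
`φ = Σσ² + Σκ² + Σω²/64`); on `{h = 0} ∩ {V ≤ 1159/1000} ∩ {κ₂, κ₃ ≤ 3/2}`: `V̇ ≤ −ε_dot·φ` (ε_dot = 1/125);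
on `{h = 0} ∩ {V ≤ 1159/1000}`: the INCLUSION identities `dom_incl_0/1` (`3/2 − κ₂ ≥ 0`, `3/2 − κ₃ ≥ 0`). D-TYPE
certificate: NO ball identity — the domain hypotheses of `Vdot_neg` are discharged by `dom_incl_0/1`,
compactness comes from `V_pos` (`φ ≤ 1000·V ≤ 1159` ⇒ `‖z‖∞ ≤ 273`), and the arc bounds are `κ₂, κ₃ ≤ 3/2`
(< 2). MODELLED: every theorem of THIS file is about the recast polynomial system `ż = F(z)` on `{h = 0} ⊂ ℝ^7`
of the instance WSCC9-postB-SPdamp-h12 (model-1's `WSCC9.postB_SPdamp.polyField`, interface I2; MODEL-VALIDITY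
MV-2+MV-P+MV-SPD+MV-ω+MV-h12). VALIDATED (not in this file; HOME bench/G1-LOG.md §9/§11): this piece catches
Anderson–Fouad's bus-7 fault-on trajectory up to t* = 0.123 s (0.70 of the simulated CCT 0.176 s; deg-2 pieces:
0.098 / 0.114 s) and covers median 0.59 of the simulated ROA rays. No sentence here says a machine or a grid is
stable. The original-coordinate statement is the sibling `WSCC9Deg4ASosgramDinstRoaModel.lean` (bridge pattern:
imports the file-of-record companion `WSCC9Deg2ASPdampH12RoaModel` of the SAME RecastData instance for the
embedding vocabulary, as `WSCC9Deg2ARecertDV2SPdampH12RoaModel.lean` p488202 does).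

STATEMENT (`deg4_A_sosgram_Dinst_roa`, `…_roa_arcs`): for every `0 < γ ≤ 1159/1000` and every solution `z` of
the recast system on `[0, ∞)` (continuous, right derivative `F (z t)`) with `z 0 ∈ {h = 0}`, `V(z 0) ≤ γ`:
`V(z t) ≤ γ` and `κ₂(t), κ₃(t) ≤ 3/2` for all `t ≥ 0`, and `z t → 0`.
-/

namespace Summit.Ventures.GridStability.Bench.WSCC9

open Set Filter Metric Topology Real
open Summit.Ventures.GridStability.Lyapunov
open Literature.Computation.Certificates Literature.Computation.Certificates.SOS

noncomputable section

/-! ### Recast phase space `Fin 7 → ℝ`, coordinates in the certificate's variable order ['sigma_2', 'kappa_2', 'sigma_3', 'kappa_3', 'omega_1', 'omega_2', 'omega_3'] -/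

/-- The recast field of the instance on `Fin 7 → ℝ` (components = the Bench decls verbatim).
MODELLED column. [folklore] -/
def deg4_A_sosgram_Dinst_F (z : Fin 7 → ℝ) : Fin 7 → ℝ :=
  ![deg4_A_sosgram_Dinst_f_sigma_2 (z 0) (z 1) (z 2) (z 3) (z 4) (z 5) (z 6),
    deg4_A_sosgram_Dinst_f_kappa_2 (z 0) (z 1) (z 2) (z 3) (z 4) (z 5) (z 6),
    deg4_A_sosgram_Dinst_f_sigma_3 (z 0) (z 1) (z 2) (z 3) (z 4) (z 5) (z 6),
    deg4_A_sosgram_Dinst_f_kappa_3 (z 0) (z 1) (z 2) (z 3) (z 4) (z 5) (z 6),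
    deg4_A_sosgram_Dinst_f_omega_1 (z 0) (z 1) (z 2) (z 3) (z 4) (z 5) (z 6),
    deg4_A_sosgram_Dinst_f_omega_2 (z 0) (z 1) (z 2) (z 3) (z 4) (z 5) (z 6),
    deg4_A_sosgram_Dinst_f_omega_3 (z 0) (z 1) (z 2) (z 3) (z 4) (z 5) (z 6)]

/-- The certificate's `V` on the phase space. [folklore] -/
def deg4_A_sosgram_Dinst_Vz (z : Fin 7 → ℝ) : ℝ := deg4_A_sosgram_Dinst_V (z 0) (z 1) (z 2) (z 3) (z 4) (z 5) (z 6)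

/-- Its Lie derivative `∇V·f` (the emitted `Vdot`). [folklore] -/
def deg4_A_sosgram_Dinst_LVz (z : Fin 7 → ℝ) : ℝ := deg4_A_sosgram_Dinst_Vdot (z 0) (z 1) (z 2) (z 3) (z 4) (z 5) (z 6)

/-- The certified dissipation rate `W = ε_dot·φ`. [folklore] -/
def deg4_A_sosgram_Dinst_Wz (z : Fin 7 → ℝ) : ℝ := ((1 : ℝ) / 125) * (((1 : ℝ) / 64) * z 6 ^ 2 + ((1 : ℝ) / 64) * z 5 ^ 2 + ((1 : ℝ) / 64) * z 4 ^ 2 + (1 : ℝ) * z 3 ^ 2 + (1 : ℝ) * z 2 ^ 2 + (1 : ℝ) * z 1 ^ 2 + (1 : ℝ) * z 0 ^ 2)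

/-- The recast constraint set `M = {h_j = 0}`. [folklore] -/
def deg4_A_sosgram_Dinst_M : Set (Fin 7 → ℝ) := {z | deg4_A_sosgram_Dinst_h1 (z 0) (z 1) (z 2) (z 3) (z 4) (z 5) (z 6) = 0 ∧ deg4_A_sosgram_Dinst_h2 (z 0) (z 1) (z 2) (z 3) (z 4) (z 5) (z 6) = 0}

/-- The certificate's level `c = 1159/1000`. [folklore] -/
def deg4_A_sosgram_Dinst_level : ℝ := ((1159 : ℝ) / 1000)

/-- Component `0` (`sigma_2`) of the recast field. [folklore] -/
@[simp] theorem deg4_A_sosgram_Dinst_F_0 (z : Fin 7 → ℝ) : deg4_A_sosgram_Dinst_F z 0 = deg4_A_sosgram_Dinst_f_sigma_2 (z 0) (z 1) (z 2) (z 3) (z 4) (z 5) (z 6) := rfl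
/-- Component `1` (`kappa_2`) of the recast field. [folklore] -/
@[simp] theorem deg4_A_sosgram_Dinst_F_1 (z : Fin 7 → ℝ) : deg4_A_sosgram_Dinst_F z 1 = deg4_A_sosgram_Dinst_f_kappa_2 (z 0) (z 1) (z 2) (z 3) (z 4) (z 5) (z 6) := rfl
/-- Component `2` (`sigma_3`) of the recast field. [folklore] -/
@[simp] theorem deg4_A_sosgram_Dinst_F_2 (z : Fin 7 → ℝ) : deg4_A_sosgram_Dinst_F z 2 = deg4_A_sosgram_Dinst_f_sigma_3 (z 0) (z 1) (z 2) (z 3) (z 4) (z 5) (z 6) := rfl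
/-- Component `3` (`kappa_3`) of the recast field. [folklore] -/
@[simp] theorem deg4_A_sosgram_Dinst_F_3 (z : Fin 7 → ℝ) : deg4_A_sosgram_Dinst_F z 3 = deg4_A_sosgram_Dinst_f_kappa_3 (z 0) (z 1) (z 2) (z 3) (z 4) (z 5) (z 6) := rfl
/-- Component `4` (`omega_1`) of the recast field. [folklore] -/
@[simp] theorem deg4_A_sosgram_Dinst_F_4 (z : Fin 7 → ℝ) : deg4_A_sosgram_Dinst_F z 4 = deg4_A_sosgram_Dinst_f_omega_1 (z 0) (z 1) (z 2) (z 3) (z 4) (z 5) (z 6) := rfl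
/-- Component `5` (`omega_2`) of the recast field. [folklore] -/
@[simp] theorem deg4_A_sosgram_Dinst_F_5 (z : Fin 7 → ℝ) : deg4_A_sosgram_Dinst_F z 5 = deg4_A_sosgram_Dinst_f_omega_2 (z 0) (z 1) (z 2) (z 3) (z 4) (z 5) (z 6) := rfl
/-- Component `6` (`omega_3`) of the recast field. [folklore] -/
@[simp] theorem deg4_A_sosgram_Dinst_F_6 (z : Fin 7 → ℝ) : deg4_A_sosgram_Dinst_F z 6 = deg4_A_sosgram_Dinst_f_omega_3 (z 0) (z 1) (z 2) (z 3) (z 4) (z 5) (z 6) := rfl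

/-! ### `V` without an explicit `_V_eq` lemma (253 monomials > the emitter's 150-term cap): generic route -/

/-- `Vz` is the kernel polynomial `V_poly` read on the phase space through `vars (List.ofFn ·)`. [folklore] -/
theorem deg4_A_sosgram_Dinst_Vz_eq_eval (w : Fin 7 → ℝ) :
    deg4_A_sosgram_Dinst_Vz w = Poly.eval (vars (List.ofFn w)) deg4_A_sosgram_Dinst_V_poly := by
  simp [deg4_A_sosgram_Dinst_Vz, deg4_A_sosgram_Dinst_V]

/-- `V` is continuous on the phase space (`Lyapunov/PolyRecastEval.continuous_eval_ofFn`). [folklore] -/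
theorem deg4_A_sosgram_Dinst_continuous_Vz : Continuous deg4_A_sosgram_Dinst_Vz := by
  have e : deg4_A_sosgram_Dinst_Vz = fun w ↦ Poly.eval (vars (List.ofFn w)) deg4_A_sosgram_Dinst_V_poly := by
    funext w; exact deg4_A_sosgram_Dinst_Vz_eq_eval w
  rw [e]
  exact PolyRecast.continuous_eval_ofFn _

set_option maxRecDepth 100000 in
/-- Every monomial of `V_poly` has a nonzero exponent (no constant term; one kernel `decide` on the literal). [folklore] -/
theorem deg4_A_sosgram_Dinst_V_noConst : (deg4_A_sosgram_Dinst_V_poly.all fun t => t.1.any fun e => decide (e ≠ 0)) = true := by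
  decide +kernel

/-- `V(0) = 0`: every monomial of `V_poly` has a nonzero exponent (one `decide` on the literal;
`Lyapunov/PolyRecastEval.eval_ofFn_zero_of_all`). [folklore] -/
theorem deg4_A_sosgram_Dinst_Vz_zero : deg4_A_sosgram_Dinst_Vz 0 = 0 := by
  rw [deg4_A_sosgram_Dinst_Vz_eq_eval]
  exact PolyRecast.eval_ofFn_zero_of_all _ deg4_A_sosgram_Dinst_V_noConst

/-! ### Algebraic consequences of the certified identities -/

/-- Dissipation inequality in bridge form on `M ∩ {V ≤ c}`: `LV ≤ −W` (domain hypotheses of the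
Bench theorem discharged by `level_in_ball`). CERTIFIED input: `deg4_A_sosgram_Dinst_Vdot_neg`. [folklore] -/
theorem deg4_A_sosgram_Dinst_LVz_le {z : Fin 7 → ℝ} (hz : z ∈ deg4_A_sosgram_Dinst_M) (hV : deg4_A_sosgram_Dinst_Vz z ≤ deg4_A_sosgram_Dinst_level) :
    deg4_A_sosgram_Dinst_LVz z ≤ -deg4_A_sosgram_Dinst_Wz z := by
  have h := deg4_A_sosgram_Dinst_Vdot_neg (z 0) (z 1) (z 2) (z 3) (z 4) (z 5) (z 6) hV (by have hb := deg4_A_sosgram_Dinst_dom_incl_0 (z 0) (z 1) (z 2) (z 3) (z 4) (z 5) (z 6) hV hz.1 hz.2; linarith) (by have hb := deg4_A_sosgram_Dinst_dom_incl_1 (z 0) (z 1) (z 2) (z 3) (z 4) (z 5) (z 6) hV hz.1 hz.2; linarith) hz.1 hz.2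
  simp only [deg4_A_sosgram_Dinst_LVz, deg4_A_sosgram_Dinst_Wz]
  linarith

/-- Arc exclusion (A6) on the certified piece: `kappa_2 ≤ 3/2`. CERTIFIED input: `deg4_A_sosgram_Dinst_dom_incl_0`. [folklore] -/
theorem deg4_A_sosgram_Dinst_arc_kappa_2 {z : Fin 7 → ℝ} (hz : z ∈ deg4_A_sosgram_Dinst_M) (hV : deg4_A_sosgram_Dinst_Vz z ≤ deg4_A_sosgram_Dinst_level) :
    z 1 ≤ ((3 : ℝ) / 2) := by
  have h := deg4_A_sosgram_Dinst_dom_incl_0 (z 0) (z 1) (z 2) (z 3) (z 4) (z 5) (z 6) hV hz.1 hz.2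
  linarith

/-- Arc exclusion (A6) on the certified piece: `kappa_3 ≤ 3/2`. CERTIFIED input: `deg4_A_sosgram_Dinst_dom_incl_1`. [folklore] -/
theorem deg4_A_sosgram_Dinst_arc_kappa_3 {z : Fin 7 → ℝ} (hz : z ∈ deg4_A_sosgram_Dinst_M) (hV : deg4_A_sosgram_Dinst_Vz z ≤ deg4_A_sosgram_Dinst_level) :
    z 3 ≤ ((3 : ℝ) / 2) := by
  have h := deg4_A_sosgram_Dinst_dom_incl_1 (z 0) (z 1) (z 2) (z 3) (z 4) (z 5) (z 6) hV hz.1 hz.2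
  linarith

/-- `W = ε·φ` is positive definite: its only zero is the origin. [folklore] -/
theorem deg4_A_sosgram_Dinst_eq_zero_of_Wz {z : Fin 7 → ℝ} (hW : deg4_A_sosgram_Dinst_Wz z = 0) : z = 0 := by
  simp only [deg4_A_sosgram_Dinst_Wz] at hW
  have e0 : z 0 = 0 := by nlinarith [sq_nonneg (z 0), sq_nonneg (z 1), sq_nonneg (z 2), sq_nonneg (z 3), sq_nonneg (z 4), sq_nonneg (z 5), sq_nonneg (z 6)]
  have e1 : z 1 = 0 := by nlinarith [sq_nonneg (z 0), sq_nonneg (z 1), sq_nonneg (z 2), sq_nonneg (z 3), sq_nonneg (z 4), sq_nonneg (z 5), sq_nonneg (z 6)]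
  have e2 : z 2 = 0 := by nlinarith [sq_nonneg (z 0), sq_nonneg (z 1), sq_nonneg (z 2), sq_nonneg (z 3), sq_nonneg (z 4), sq_nonneg (z 5), sq_nonneg (z 6)]
  have e3 : z 3 = 0 := by nlinarith [sq_nonneg (z 0), sq_nonneg (z 1), sq_nonneg (z 2), sq_nonneg (z 3), sq_nonneg (z 4), sq_nonneg (z 5), sq_nonneg (z 6)]
  have e4 : z 4 = 0 := by nlinarith [sq_nonneg (z 0), sq_nonneg (z 1), sq_nonneg (z 2), sq_nonneg (z 3), sq_nonneg (z 4), sq_nonneg (z 5), sq_nonneg (z 6)]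
  have e5 : z 5 = 0 := by nlinarith [sq_nonneg (z 0), sq_nonneg (z 1), sq_nonneg (z 2), sq_nonneg (z 3), sq_nonneg (z 4), sq_nonneg (z 5), sq_nonneg (z 6)]
  have e6 : z 6 = 0 := by nlinarith [sq_nonneg (z 0), sq_nonneg (z 1), sq_nonneg (z 2), sq_nonneg (z 3), sq_nonneg (z 4), sq_nonneg (z 5), sq_nonneg (z 6)]
  funext i
  fin_cases i <;> simp [e0, e1, e2, e3, e4, e5, e6]

/-- Strictness on every level surface `{V = γ}`, `γ > 0`: `W > 0` there. [folklore] -/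
theorem deg4_A_sosgram_Dinst_Wz_pos {z : Fin 7 → ℝ} {γ : ℝ} (hγ0 : 0 < γ) (hV : deg4_A_sosgram_Dinst_Vz z = γ) :
    0 < deg4_A_sosgram_Dinst_Wz z := by
  have hW0 : 0 ≤ deg4_A_sosgram_Dinst_Wz z := by simp only [deg4_A_sosgram_Dinst_Wz]; positivity
  rcases hW0.lt_or_eq with h | h
  · exact h
  · exfalso
    have hz0 := deg4_A_sosgram_Dinst_eq_zero_of_Wz h.symm
    subst hz0
    rw [deg4_A_sosgram_Dinst_Vz_zero] at hV
    linarith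

/-- Compactness of the certified piece `S = {z ∈ M | V z ≤ c}` (closed; bounded by
`V_pos`: `‖z‖∞ ≤ 273`). [folklore] -/
theorem deg4_A_sosgram_Dinst_isCompact_S : IsCompact {z ∈ deg4_A_sosgram_Dinst_M | deg4_A_sosgram_Dinst_Vz z ≤ deg4_A_sosgram_Dinst_level} := by
  have hMc : IsClosed deg4_A_sosgram_Dinst_M := by
    simp only [deg4_A_sosgram_Dinst_M, deg4_A_sosgram_Dinst_h1_eq, deg4_A_sosgram_Dinst_h2_eq]
    exact (isClosed_eq (by fun_prop) continuous_const).inter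
      (isClosed_eq (by fun_prop) continuous_const)
  have hVc : Continuous deg4_A_sosgram_Dinst_Vz := deg4_A_sosgram_Dinst_continuous_Vz
  have h := isCompact_sublevel_of_norm_le (D := univ) (c := deg4_A_sosgram_Dinst_level) (R := (273 : ℝ)) hMc
    isClosed_univ hVc.continuousOn ?_
  · rwa [inter_univ] at h
  rintro z ⟨hz, -⟩ hV
  have hball := deg4_A_sosgram_Dinst_V_pos (z 0) (z 1) (z 2) (z 3) (z 4) (z 5) (z 6) hz.1 hz.2
  have hlev : deg4_A_sosgram_Dinst_Vz z ≤ ((1159 : ℝ) / 1000) := by simpa only [deg4_A_sosgram_Dinst_level] using hV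
  simp only [deg4_A_sosgram_Dinst_Vz] at hlev
  have hb0 : |z 0| ≤ (273 : ℝ) :=
    abs_le.2 (abs_le_of_sq_le_sq' (by nlinarith [hball, hlev, sq_nonneg (z 1), sq_nonneg (z 2), sq_nonneg (z 3), sq_nonneg (z 4), sq_nonneg (z 5), sq_nonneg (z 6)]) (by norm_num))
  have hb1 : |z 1| ≤ (273 : ℝ) :=
    abs_le.2 (abs_le_of_sq_le_sq' (by nlinarith [hball, hlev, sq_nonneg (z 0), sq_nonneg (z 2), sq_nonneg (z 3), sq_nonneg (z 4), sq_nonneg (z 5), sq_nonneg (z 6)]) (by norm_num))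
  have hb2 : |z 2| ≤ (273 : ℝ) :=
    abs_le.2 (abs_le_of_sq_le_sq' (by nlinarith [hball, hlev, sq_nonneg (z 0), sq_nonneg (z 1), sq_nonneg (z 3), sq_nonneg (z 4), sq_nonneg (z 5), sq_nonneg (z 6)]) (by norm_num))
  have hb3 : |z 3| ≤ (273 : ℝ) :=
    abs_le.2 (abs_le_of_sq_le_sq' (by nlinarith [hball, hlev, sq_nonneg (z 0), sq_nonneg (z 1), sq_nonneg (z 2), sq_nonneg (z 4), sq_nonneg (z 5), sq_nonneg (z 6)]) (by norm_num))
  have hb4 : |z 4| ≤ (273 : ℝ) :=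
    abs_le.2 (abs_le_of_sq_le_sq' (by nlinarith [hball, hlev, sq_nonneg (z 0), sq_nonneg (z 1), sq_nonneg (z 2), sq_nonneg (z 3), sq_nonneg (z 5), sq_nonneg (z 6)]) (by norm_num))
  have hb5 : |z 5| ≤ (273 : ℝ) :=
    abs_le.2 (abs_le_of_sq_le_sq' (by nlinarith [hball, hlev, sq_nonneg (z 0), sq_nonneg (z 1), sq_nonneg (z 2), sq_nonneg (z 3), sq_nonneg (z 4), sq_nonneg (z 6)]) (by norm_num))
  have hb6 : |z 6| ≤ (273 : ℝ) :=
    abs_le.2 (abs_le_of_sq_le_sq' (by nlinarith [hball, hlev, sq_nonneg (z 0), sq_nonneg (z 1), sq_nonneg (z 2), sq_nonneg (z 3), sq_nonneg (z 4), sq_nonneg (z 5)]) (by norm_num))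
  refine (pi_norm_le_iff_of_nonneg (by norm_num)).2 fun i ↦ ?_
  rw [Real.norm_eq_abs]
  fin_cases i
  · simpa using hb0
  · simpa using hb1
  · simpa using hb2
  · simpa using hb3
  · simpa using hb4
  · simpa using hb5
  · simpa using hb6

/-! ### Calculus along a solution of the recast system (generic route: `Lyapunov/PolyRecast.lean`) -/

/-- Coordinatewise form of a solution of the recast system, in the `PolyRecast` vocabulary. [folklore] -/
theorem deg4_A_sosgram_Dinst_hasDerivWithinAt_coord {z : ℝ → Fin 7 → ℝ} {t : ℝ} {s : Set ℝ}
    (hz : HasDerivWithinAt z (deg4_A_sosgram_Dinst_F (z t)) s t) (i : Fin 7) :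
    HasDerivWithinAt (fun τ ↦ z τ i)
      (Poly.eval (vars (List.ofFn (z t))) ([deg4_A_sosgram_Dinst_f_sigma_2_poly, deg4_A_sosgram_Dinst_f_kappa_2_poly, deg4_A_sosgram_Dinst_f_sigma_3_poly, deg4_A_sosgram_Dinst_f_kappa_3_poly, deg4_A_sosgram_Dinst_f_omega_1_poly, deg4_A_sosgram_Dinst_f_omega_2_poly, deg4_A_sosgram_Dinst_f_omega_3_poly].getD i [])) s t := by
  have h := (hasDerivWithinAt_pi.1 hz) i
  fin_cases i <;> simpa [deg4_A_sosgram_Dinst_F, deg4_A_sosgram_Dinst_f_sigma_2, deg4_A_sosgram_Dinst_f_kappa_2, deg4_A_sosgram_Dinst_f_sigma_3, deg4_A_sosgram_Dinst_f_kappa_3, deg4_A_sosgram_Dinst_f_omega_1, deg4_A_sosgram_Dinst_f_omega_2, deg4_A_sosgram_Dinst_f_omega_3] using h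

/-- **Chain rule**: along a curve with right derivative `F (z t)`, `V ∘ z` has derivative
`LV (z t) = Vdot(z t)` (`PolyRecastLieChunks.hasDerivWithinAt_eval_of_links`, chunked Lie link). [folklore] -/
theorem deg4_A_sosgram_Dinst_hasDerivWithinAt_Vz {z : ℝ → Fin 7 → ℝ} {t : ℝ} {s : Set ℝ}
    (hz : HasDerivWithinAt z (deg4_A_sosgram_Dinst_F (z t)) s t) :
    HasDerivWithinAt (deg4_A_sosgram_Dinst_Vz ∘ z) (deg4_A_sosgram_Dinst_LVz (z t)) s t := by
  have h := PolyRecast.hasDerivWithinAt_eval_of_links (N := 7) (M := 7)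
    (Ps := [([] : Poly), deg4_A_sosgram_Dinst_lieP_1, deg4_A_sosgram_Dinst_lieP_2, deg4_A_sosgram_Dinst_lieP_3, deg4_A_sosgram_Dinst_lieP_4, deg4_A_sosgram_Dinst_lieP_5, deg4_A_sosgram_Dinst_lieP_6, deg4_A_sosgram_Dinst_lieP_7])
    (by decide) deg4_A_sosgram_Dinst_V_numVars rfl deg4_A_sosgram_Dinst_lieLinks deg4_A_sosgram_Dinst_lieFinal (deg4_A_sosgram_Dinst_hasDerivWithinAt_coord hz)
  have e1 : deg4_A_sosgram_Dinst_Vz ∘ z = fun τ ↦ Poly.eval (vars (List.ofFn (z τ))) deg4_A_sosgram_Dinst_V_poly := by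
    funext τ; simp [deg4_A_sosgram_Dinst_Vz, deg4_A_sosgram_Dinst_V]
  have e2 : deg4_A_sosgram_Dinst_LVz (z t) = Poly.eval (vars (List.ofFn (z t))) deg4_A_sosgram_Dinst_Vdot_poly := by
    simp [deg4_A_sosgram_Dinst_LVz, deg4_A_sosgram_Dinst_Vdot]
  rw [e1, e2]
  exact h

/-- `deg4_A_sosgram_Dinst_h1` has zero Lie derivative along `f` (one `decide`). [folklore] -/
theorem deg4_A_sosgram_Dinst_h1_isFirstIntegral : Poly.isZero (Poly.lieDeriv [deg4_A_sosgram_Dinst_f_sigma_2_poly, deg4_A_sosgram_Dinst_f_kappa_2_poly, deg4_A_sosgram_Dinst_f_sigma_3_poly, deg4_A_sosgram_Dinst_f_kappa_3_poly, deg4_A_sosgram_Dinst_f_omega_1_poly, deg4_A_sosgram_Dinst_f_omega_2_poly, deg4_A_sosgram_Dinst_f_omega_3_poly] deg4_A_sosgram_Dinst_h1_poly) = true := by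
  decide +kernel

/-- **`deg4_A_sosgram_Dinst_h1` is a first integral** of the recast field: `deg4_A_sosgram_Dinst_h1 ∘ z` has right derivative `0`.
[folklore] -/
theorem deg4_A_sosgram_Dinst_hasDerivWithinAt_h1 {z : ℝ → Fin 7 → ℝ} {t : ℝ} {s : Set ℝ}
    (hz : HasDerivWithinAt z (deg4_A_sosgram_Dinst_F (z t)) s t) :
    HasDerivWithinAt (fun τ ↦ deg4_A_sosgram_Dinst_h1 (z τ 0) (z τ 1) (z τ 2) (z τ 3) (z τ 4) (z τ 5) (z τ 6)) 0 s t := by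
  have h := PolyRecast.hasDerivWithinAt_eval_zero_of_isZero (by decide) deg4_A_sosgram_Dinst_h1_isFirstIntegral
    (deg4_A_sosgram_Dinst_hasDerivWithinAt_coord hz)
  have e : (fun τ ↦ deg4_A_sosgram_Dinst_h1 (z τ 0) (z τ 1) (z τ 2) (z τ 3) (z τ 4) (z τ 5) (z τ 6))
      = fun τ ↦ Poly.eval (vars (List.ofFn (z τ))) deg4_A_sosgram_Dinst_h1_poly := by
    funext τ; simp [deg4_A_sosgram_Dinst_h1]
  rw [e]
  exact h

/-- `deg4_A_sosgram_Dinst_h2` has zero Lie derivative along `f` (one `decide`). [folklore] -/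
theorem deg4_A_sosgram_Dinst_h2_isFirstIntegral : Poly.isZero (Poly.lieDeriv [deg4_A_sosgram_Dinst_f_sigma_2_poly, deg4_A_sosgram_Dinst_f_kappa_2_poly, deg4_A_sosgram_Dinst_f_sigma_3_poly, deg4_A_sosgram_Dinst_f_kappa_3_poly, deg4_A_sosgram_Dinst_f_omega_1_poly, deg4_A_sosgram_Dinst_f_omega_2_poly, deg4_A_sosgram_Dinst_f_omega_3_poly] deg4_A_sosgram_Dinst_h2_poly) = true := by
  decide +kernel

/-- **`deg4_A_sosgram_Dinst_h2` is a first integral** of the recast field: `deg4_A_sosgram_Dinst_h2 ∘ z` has right derivative `0`.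
[folklore] -/
theorem deg4_A_sosgram_Dinst_hasDerivWithinAt_h2 {z : ℝ → Fin 7 → ℝ} {t : ℝ} {s : Set ℝ}
    (hz : HasDerivWithinAt z (deg4_A_sosgram_Dinst_F (z t)) s t) :
    HasDerivWithinAt (fun τ ↦ deg4_A_sosgram_Dinst_h2 (z τ 0) (z τ 1) (z τ 2) (z τ 3) (z τ 4) (z τ 5) (z τ 6)) 0 s t := by
  have h := PolyRecast.hasDerivWithinAt_eval_zero_of_isZero (by decide) deg4_A_sosgram_Dinst_h2_isFirstIntegral
    (deg4_A_sosgram_Dinst_hasDerivWithinAt_coord hz)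
  have e : (fun τ ↦ deg4_A_sosgram_Dinst_h2 (z τ 0) (z τ 1) (z τ 2) (z τ 3) (z τ 4) (z τ 5) (z τ 6))
      = fun τ ↦ Poly.eval (vars (List.ofFn (z τ))) deg4_A_sosgram_Dinst_h2_poly := by
    funext τ; simp [deg4_A_sosgram_Dinst_h2]
  rw [e]
  exact h

/-- A solution of the recast system starting on `M` stays on `M` (the constraints are first
integrals). [folklore] -/
theorem deg4_A_sosgram_Dinst_mem_M {z : ℝ → Fin 7 → ℝ} (hzc : ContinuousOn z (Ici 0))
    (hz : ∀ t, 0 ≤ t → HasDerivWithinAt z (deg4_A_sosgram_Dinst_F (z t)) (Ici t) t)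
    (h0 : z 0 ∈ deg4_A_sosgram_Dinst_M) : ∀ t, 0 ≤ t → z t ∈ deg4_A_sosgram_Dinst_M := by
  intro T hT
  have hc0 : ContinuousOn (fun τ ↦ deg4_A_sosgram_Dinst_h1 (z τ 0) (z τ 1) (z τ 2) (z τ 3) (z τ 4) (z τ 5) (z τ 6)) (Icc 0 T) := by
    have hc : Continuous fun y : Fin 7 → ℝ ↦ deg4_A_sosgram_Dinst_h1 (y 0) (y 1) (y 2) (y 3) (y 4) (y 5) (y 6) := by
      simp only [deg4_A_sosgram_Dinst_h1_eq]; fun_prop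
    exact hc.comp_continuousOn (hzc.mono fun s hs ↦ hs.1)
  have k0 := constant_of_has_deriv_right_zero hc0
    (fun t ht ↦ deg4_A_sosgram_Dinst_hasDerivWithinAt_h1 (hz t ht.1)) T ⟨hT, le_rfl⟩
  have z0 : deg4_A_sosgram_Dinst_h1 (z 0 0) (z 0 1) (z 0 2) (z 0 3) (z 0 4) (z 0 5) (z 0 6) = 0 := h0.1
  have hc1 : ContinuousOn (fun τ ↦ deg4_A_sosgram_Dinst_h2 (z τ 0) (z τ 1) (z τ 2) (z τ 3) (z τ 4) (z τ 5) (z τ 6)) (Icc 0 T) := by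
    have hc : Continuous fun y : Fin 7 → ℝ ↦ deg4_A_sosgram_Dinst_h2 (y 0) (y 1) (y 2) (y 3) (y 4) (y 5) (y 6) := by
      simp only [deg4_A_sosgram_Dinst_h2_eq]; fun_prop
    exact hc.comp_continuousOn (hzc.mono fun s hs ↦ hs.1)
  have k1 := constant_of_has_deriv_right_zero hc1
    (fun t ht ↦ deg4_A_sosgram_Dinst_hasDerivWithinAt_h2 (hz t ht.1)) T ⟨hT, le_rfl⟩
  have z1 : deg4_A_sosgram_Dinst_h2 (z 0 0) (z 0 1) (z 0 2) (z 0 3) (z 0 4) (z 0 5) (z 0 6) = 0 := h0.2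
  exact ⟨by show deg4_A_sosgram_Dinst_h1 (z T 0) (z T 1) (z T 2) (z T 3) (z T 4) (z T 5) (z T 6) = 0; rw [k0, z0], by show deg4_A_sosgram_Dinst_h2 (z T 0) (z T 1) (z T 2) (z T 3) (z T 4) (z T 5) (z T 6) = 0; rw [k1, z1]⟩

/-! ### The ROA inclusion for the recast model -/

/-- **G1-roa (recast coordinates).** MODELLED: the recast polynomial system `ż = F(z)` on
`{h = 0}` of the instance (model-1's `polyField`, interface I2; MODEL-VALIDITY row of the Bench
file). CERTIFIED inputs: the kernel-checked identities of the Bench file. STATEMENT: for every level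
`0 < γ ≤ c = 1159/1000` and every solution `z` on `[0, ∞)` (Mathlib sense: continuous, right derivative
`F (z t)`) with `z 0 ∈ M`, `V(z 0) ≤ γ`: `V(z t) ≤ γ` for all `t ≥ 0`, and `z t → 0`.
Via `Lyapunov.certificate_invariance_tendsto_univ`. No sentence here says a machine or a grid is
stable. [folklore] -/
theorem deg4_A_sosgram_Dinst_roa {γ : ℝ} (hγ0 : 0 < γ) (hγ : γ ≤ deg4_A_sosgram_Dinst_level) {z : ℝ → Fin 7 → ℝ}
    (hzc : ContinuousOn z (Ici 0))
    (hz : ∀ t, 0 ≤ t → HasDerivWithinAt z (deg4_A_sosgram_Dinst_F (z t)) (Ici t) t)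
    (h0M : z 0 ∈ deg4_A_sosgram_Dinst_M) (h0V : deg4_A_sosgram_Dinst_Vz (z 0) ≤ γ) :
    (∀ t, 0 ≤ t → deg4_A_sosgram_Dinst_Vz (z t) ≤ γ) ∧ Tendsto z atTop (𝓝 0) := by
  have hF : Continuous deg4_A_sosgram_Dinst_F := by
    refine continuous_pi fun i ↦ ?_
    fin_cases i <;> simp [deg4_A_sosgram_Dinst_F, deg4_A_sosgram_Dinst_f_sigma_2_eq, deg4_A_sosgram_Dinst_f_kappa_2_eq, deg4_A_sosgram_Dinst_f_sigma_3_eq, deg4_A_sosgram_Dinst_f_kappa_3_eq, deg4_A_sosgram_Dinst_f_omega_1_eq, deg4_A_sosgram_Dinst_f_omega_2_eq, deg4_A_sosgram_Dinst_f_omega_3_eq] <;> fun_prop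
  have hV : Continuous deg4_A_sosgram_Dinst_Vz := deg4_A_sosgram_Dinst_continuous_Vz
  have hW : Continuous deg4_A_sosgram_Dinst_Wz := by unfold deg4_A_sosgram_Dinst_Wz; fun_prop
  have h0 : (0 : Fin 7 → ℝ) ∈ deg4_A_sosgram_Dinst_M := by simp [deg4_A_sosgram_Dinst_M, deg4_A_sosgram_Dinst_h1_eq, deg4_A_sosgram_Dinst_h2_eq]
  have hMc : IsClosed deg4_A_sosgram_Dinst_M := by
    simp only [deg4_A_sosgram_Dinst_M, deg4_A_sosgram_Dinst_h1_eq, deg4_A_sosgram_Dinst_h2_eq]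
    exact (isClosed_eq (by fun_prop) continuous_const).inter
      (isClosed_eq (by fun_prop) continuous_const)
  have hSγ : IsCompact {y ∈ deg4_A_sosgram_Dinst_M | deg4_A_sosgram_Dinst_Vz y ≤ γ} :=
    deg4_A_sosgram_Dinst_isCompact_S.of_isClosed_subset (hMc.inter (isClosed_le hV continuous_const))
      (fun y hy ↦ ⟨hy.1, hy.2.trans hγ⟩)
  have h := certificate_invariance_tendsto_univ (M := deg4_A_sosgram_Dinst_M) (LV := deg4_A_sosgram_Dinst_LVz) (W := deg4_A_sosgram_Dinst_Wz)
    (x₀ := 0) hSγ hF.continuousOn hV.continuousOn hW.continuousOn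
    (fun y hy hVy ↦ deg4_A_sosgram_Dinst_LVz_le hy (hVy.trans hγ))
    (fun y _ _ ↦ by simp only [deg4_A_sosgram_Dinst_Wz]; positivity)
    (fun y _ hVy ↦ deg4_A_sosgram_Dinst_Wz_pos hγ0 hVy)
    h0 (by rw [deg4_A_sosgram_Dinst_Vz_zero]; exact hγ0.le) (by simp [deg4_A_sosgram_Dinst_Wz])
    (fun y _ _ hWy ↦ deg4_A_sosgram_Dinst_eq_zero_of_Wz hWy)
    hzc hz (fun t ht ↦ deg4_A_sosgram_Dinst_hasDerivWithinAt_Vz (hz t ht)) (deg4_A_sosgram_Dinst_mem_M hzc hz h0M) h0V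
  have hM := deg4_A_sosgram_Dinst_mem_M hzc hz h0M
  exact ⟨fun t ht ↦ h.1 t ht, h.2⟩

/-- **Arc bounds along the certified piece** (D-type: from the certified INCLUSION identities
`dom_incl_0/1`): every solution as in `deg4_A_sosgram_Dinst_roa` keeps `κ₂ ≤ 3/2` and `κ₃ ≤ 3/2` for all `t ≥ 0`
(PARTITION A6; `< 2`, what `RecastAngleRecovery` needs). [folklore] -/
theorem deg4_A_sosgram_Dinst_roa_arcs {γ : ℝ} (hγ0 : 0 < γ) (hγ : γ ≤ deg4_A_sosgram_Dinst_level) {z : ℝ → Fin 7 → ℝ}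
    (hzc : ContinuousOn z (Ici 0))
    (hz : ∀ t, 0 ≤ t → HasDerivWithinAt z (deg4_A_sosgram_Dinst_F (z t)) (Ici t) t)
    (h0M : z 0 ∈ deg4_A_sosgram_Dinst_M) (h0V : deg4_A_sosgram_Dinst_Vz (z 0) ≤ γ) :
    (∀ t, 0 ≤ t → deg4_A_sosgram_Dinst_Vz (z t) ≤ γ ∧ (z t 1 ≤ ((3 : ℝ) / 2) ∧ z t 3 ≤ ((3 : ℝ) / 2))) ∧
      Tendsto z atTop (𝓝 0) := by
  obtain ⟨hinv, hlim⟩ := deg4_A_sosgram_Dinst_roa hγ0 hγ hzc hz h0M h0V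
  have hM := deg4_A_sosgram_Dinst_mem_M hzc hz h0M
  refine ⟨fun t ht ↦ ⟨hinv t ht, ?_, ?_⟩, hlim⟩
  · exact deg4_A_sosgram_Dinst_arc_kappa_2 (hM t ht) ((hinv t ht).trans hγ)
  · exact deg4_A_sosgram_Dinst_arc_kappa_3 (hM t ht) ((hinv t ht).trans hγ)

end

end Summit.Ventures.GridStability.Bench.WSCC9
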